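import Literature.NumberTheory.EllipticCurves.ModularPolynomialIntegral
import Literature.NumberTheory.EllipticCurves.ModularLinkConjugacy
import Literature.NumberTheory.EllipticCurves.ComplexMultiplicationClassPolynomialRootProofs
import HarnessLib

/-!
# All singular moduli of a given discriminant are conjugate over `ℚ`
# (Cox, *Primes of the form x² + ny²*, §13.A: `H_𝒪(X)` is the minimal polynomial of every `j(𝔞)`)

Topic `NumberTheory/EllipticCurves` (complex multiplication).  The named fact
`singularModuli_conjugate` — for primitive positive definite forms `Q, Q'` of the same discriminant
`D < 0`, every `G ∈ ℚ[X]` with `G(j(τ_Q)) = 0` has `G(j(τ_{Q'})) = 0` — and its proof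
`singularModuli_conjugate_holds`, **without class field theory**.  This is the part of the "First Main
Theorem" (Cox §13.A Prop. 13.2 and the remark following it, p. 289: the class equation
`H_D = ∏ (X − j(𝔞))` is the minimal polynomial of every `j(𝔞)`) that the reduction of `finite_point_of_hasCM_of_L_one_ne_zero` actually uses (a rational singular
modulus forces `h(D) = 1`, `ComplexMultiplicationHasCMTwoLeavesProofs.lean`); it replaces the named
fact `irreducible_classPolynomial` there.

## The proof (Cox §11.C–D rearranged; Deuring 1958)

* **Links.**  For `e ∣ a` let `Q_e = (a/e, b, ce)` (`scaleForm`), of the same discriminant, with Heegner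
  point `τ_{Q_e} = e·τ_Q` (`coe_heegnerTau_scaleForm`).  For a prime `ℓ` with `eℓ ∣ a`,
  `τ_{Q_{eℓ}} = ℓ·τ_{Q_e}` and `τ_{Q_e} = (τ_{Q_{eℓ}} + 0)/ℓ`, so the modular equation gives both
  `Φ_ℓ(j(τ_{Q_{eℓ}}), j(τ_{Q_e})) = 0` and `Φ_ℓ(j(τ_{Q_e}), j(τ_{Q_{eℓ}})) = 0`
  (`evalXY_intModularPolynomial_scaleForm_up/down`, from `intModularPolynomial_kleinJ_mulPoint/divPoint`,
  Cox §11.B (11.15)).  `Q_1 = Q` and `Q_a = (1, b, ca)`, whose `j` is that of the principal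
  form (`formJ_scaleForm_natAbs_fst`, `formJ_eq_formJ_principalForm`).
* **Algebraicity** travels along links since `Φ_ℓ` is monic in `X` (`isIntegral_of_evalXY_eq_zero`,
  `isIntegral_formJ_scaleForm`, `isIntegral_formJ_of_scaleForm`).
* **Conjugacy** travels along links at good primes by the Frobenius argument
  `minpoly_eq_of_modularLink` (`ModularLinkConjugacy.lean`, Cox (11.30)–(11.33)) applied with
  `Φ = Φ_ℓ ∈ ℤ[X, Y]` and Kronecker's congruence (`dvd_coeff_coeff_intModularPolynomial_sub`):
  `minpoly_formJ_scaleForm`.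
* **Good representatives** (Cox Lemma 2.25 with Lemma 2.3): every class contains a form with `a`
  prime to any given `M` (`exists_formJ_eq_fst_coprime`), in particular to `D` (so that all `Q_e` are
  primitive, `isPrimitive_scaleForm`) and to the finitely many bad primes of
  `S = {j(τ_Q) : Q reduced of discriminant D}`.
* **Assembly** (`singularModuli_conjugate_holds`): if `G ≠ 0` kills `j(τ_Q)` then `j(τ_Q)` is algebraic,
  hence (chains) so is every element of `S`; chains from good representatives of `Q` and `Q'` to the
  principal form give `minpoly j(τ_Q) = minpoly j(τ_P) = minpoly j(τ_{Q'})`.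

## Mathlib / tree search

Tree: `formJ`, `formJ_eq_of_properEquiv`, `BinQF.exists_properEquiv_isReduced`, `heegnerTau`,
`coe_heegnerTau`, `reducedForms`, `principalForm` (QuadraticFields, EllipticCurves); the modular
polynomial files of this line (`ModularPolynomial*.lean`, `ModularLinkConjugacy.lean`).  `lean search`
for "singular moduli conjugate", "class equation irreducible": only the named fact
`irreducible_classPolynomial` (unproved).  Mathlib has no complex multiplication.

## References

* D. A. Cox, *Primes of the form x² + ny²*, 2nd ed., Wiley 2013: §2.A Lemma 2.3, Thm. 2.8; §2.C
  Lemma 2.25; §11.B (11.15); §11.C Thm. 11.18; §11.D proof of Thm. 11.1, (11.30)–(11.33); §13.A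
  Prop. 13.2 and the remark following it (p. 289).  [Cox2013]
* M. Deuring, *Die Klassenkörper der komplexen Multiplikation*, Enzykl. Math. Wiss. I.2.23 (1958), §10.
-/

noncomputable section

open Polynomial UpperHalfPlane
open scoped MatrixGroups

namespace Literature.NumberTheory.EllipticCurves

open Literature.NumberTheory.QuadraticFields.BinaryQuadraticForm
  Literature.NumberTheory.QuadraticFields.Quadratic Literature.NumberTheory.EllipticCurves.ModularForms

/-! ### Scaling the first coefficient: the forms `(a/e, b, ce)` and their CM points `e·τ_Q` -/

/-- For `e ∣ a`, the form `(a/e, b, ce)` of the same discriminant, whose CM point is `e·τ_{(a,b,c)}`;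
its lattice `ℤ·eτ_Q + ℤ` is the index-`e` sublattice chain used to link `j(τ_Q)` to `j` of the
principal class (Cox §7: `[a, (−b+√D)/2]` and its sublattices; here in the language of forms). [folklore] -/
def scaleForm (e : ℕ) (Q : ℤ × ℤ × ℤ) : ℤ × ℤ × ℤ := (Q.1 / e, Q.2.1, Q.2.2 * e)

/-- Unfolding the discriminant of a triple. [folklore] -/
lemma discr_eq (Q : ℤ × ℤ × ℤ) : discr Q = Q.2.1 ^ 2 - 4 * Q.1 * Q.2.2 := rfl

variable {Q : ℤ × ℤ × ℤ} {e : ℕ}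

/-- `scaleForm 1 Q = Q`. [folklore] -/
@[simp] lemma scaleForm_one (Q : ℤ × ℤ × ℤ) : scaleForm 1 Q = Q := by
  simp [scaleForm]

/-- The discriminant is unchanged: `b² − 4(a/e)(ce) = b² − 4ac`. [folklore] -/
lemma discr_scaleForm (he : (e : ℤ) ∣ Q.1) : discr (scaleForm e Q) = discr Q := by
  rw [scaleForm, discr_apply, discr_eq]
  have : Q.1 / e * (Q.2.2 * e) = Q.1 * Q.2.2 := by
    rw [mul_comm Q.2.2, ← mul_assoc, Int.ediv_mul_cancel he]
  linear_combination (-4 : ℤ) * this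

/-- The first coefficient `a/e` is positive. [folklore] -/
lemma scaleForm_fst_pos (hQ : 0 < Q.1) (he : 0 < e) (hdvd : (e : ℤ) ∣ Q.1) : 0 < (scaleForm e Q).1 :=
  Int.ediv_pos_of_pos_of_dvd hQ (by exact_mod_cast he.le) hdvd

/-- If `gcd(a, D) = 1` then `(a/e, b, ce)` is primitive (a common divisor of `a/e` and `b` divides `a`
and `b² − 4ac`). [folklore] -/
lemma isPrimitive_scaleForm (hcop : IsCoprime Q.1 (discr Q)) (hdvd : (e : ℤ) ∣ Q.1) :
    IsPrimitive (scaleForm e Q) := by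
  rw [isPrimitive_iff_binQF, BinQF.isPrimitive_iff]
  intro d ha hb _
  simp only [scaleForm] at ha hb
  have ha' : d ∣ Q.1 := ha.trans (Int.ediv_dvd_of_dvd hdvd)
  have hD : d ∣ discr Q := by
    rw [discr_eq]
    exact dvd_sub (dvd_pow hb two_ne_zero) (dvd_mul_of_dvd_left (dvd_mul_of_dvd_right ha' 4) _)
  exact hcop.isUnit_of_dvd' ha' hD

/-- **The CM point of `(a/e, b, ce)` is `e · τ_Q`** (same radicand `4(a/e)(ce) − b² = 4ac − b²`). [folklore] -/
lemma coe_heegnerTau_scaleForm (hQ : 0 < Q.1) (hdisc : discr Q < 0) (he : 0 < e) (hdvd : (e : ℤ) ∣ Q.1) :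
    (heegnerTau (scaleForm e Q) : ℂ) = (e : ℂ) * heegnerTau Q := by
  have h1 : 0 < (scaleForm e Q).1 := scaleForm_fst_pos hQ he hdvd
  have h2 : (scaleForm e Q).2.1 ^ 2 - 4 * (scaleForm e Q).1 * (scaleForm e Q).2.2 < 0 := by
    have := discr_scaleForm (Q := Q) hdvd; rw [discr_eq] at this; rw [this]; exact hdisc
  have hdisc' : Q.2.1 ^ 2 - 4 * Q.1 * Q.2.2 < 0 := hdisc
  rw [coe_heegnerTau h1 h2, coe_heegnerTau hQ hdisc']
  have hrad : (4 * ((scaleForm e Q).1 : ℝ) * (scaleForm e Q).2.2 - (scaleForm e Q).2.1 ^ 2 : ℝ) =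
      4 * Q.1 * Q.2.2 - Q.2.1 ^ 2 := by
    have : (scaleForm e Q).1 * (scaleForm e Q).2.2 = Q.1 * Q.2.2 := by
      simp only [scaleForm]
      rw [mul_comm Q.2.2, ← mul_assoc, Int.ediv_mul_cancel hdvd]
    have := congrArg (Int.cast : ℤ → ℝ) this
    push_cast at this
    have hb : ((scaleForm e Q).2.1 : ℝ) = Q.2.1 := by simp [scaleForm]
    rw [hb]
    linear_combination (4 : ℝ) * this
  have hA : ((scaleForm e Q).1 : ℝ) = Q.1 / e := by
    simp only [scaleForm]
    rw [Int.cast_div hdvd (by exact_mod_cast he.ne')]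
    push_cast; ring
  have he0 : (e : ℝ) ≠ 0 := by exact_mod_cast he.ne'
  have hQ0 : (Q.1 : ℝ) ≠ 0 := by exact_mod_cast hQ.ne'
  apply Complex.ext
  · simp only [Complex.mul_re, Complex.natCast_re, Complex.natCast_im, zero_mul, sub_zero]
    rw [hA]
    show -((scaleForm e Q).2.1 : ℝ) / (2 * (Q.1 / e)) = e * (-(Q.2.1 : ℝ) / (2 * Q.1))
    simp only [scaleForm]
    field_simp
  · simp only [Complex.mul_im, Complex.natCast_re, Complex.natCast_im, zero_mul, add_zero]
    rw [hrad, hA]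
    field_simp

/-- `j`-invariant of a form as a value of Klein's `j`: `formJ Q = j(τ_Q)`. [folklore] -/
lemma formJ_eq_kleinJ (Q : ℤ × ℤ × ℤ) : formJ Q = kleinJ (heegnerTau Q) := by
  rw [formJ_def, kleinJ_eq_periodPair_j]

section ModularLinks

variable {ℓ : ℕ} [Fact ℓ.Prime]

/-- `τ_{(a/(eℓ), b, ceℓ)} = ℓ · τ_{(a/e, b, ce)}`. [folklore] -/
lemma heegnerTau_scaleForm_mul (hQ : 0 < Q.1) (hdisc : discr Q < 0) (he : 0 < e) (hdvd : ((e * ℓ : ℕ) : ℤ) ∣ Q.1) :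
    heegnerTau (scaleForm (e * ℓ) Q) = mulPoint ℓ (heegnerTau (scaleForm e Q)) := by
  have hℓ := (Fact.out : ℓ.Prime).pos
  have hdvd' : (e : ℤ) ∣ Q.1 := (Int.natCast_dvd_natCast.mpr (dvd_mul_right e ℓ) |>.trans ?_)
  swap; · exact_mod_cast hdvd
  apply UpperHalfPlane.ext
  rw [coe_mulPoint, coe_heegnerTau_scaleForm hQ hdisc (Nat.mul_pos he hℓ) hdvd,
    coe_heegnerTau_scaleForm hQ hdisc he hdvd']
  push_cast; ring

/-- `τ_{(a/e, b, ce)} = (ℓ · τ_{(a/e, b, ce)} + 0)/ℓ = divPoint ℓ 0 (τ_{(a/(eℓ), b, ceℓ)})`. [folklore] -/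
lemma heegnerTau_scaleForm_eq_divPoint (hQ : 0 < Q.1) (hdisc : discr Q < 0) (he : 0 < e)
    (hdvd : ((e * ℓ : ℕ) : ℤ) ∣ Q.1) :
    heegnerTau (scaleForm e Q) = divPoint ℓ 0 (heegnerTau (scaleForm (e * ℓ) Q)) := by
  have hℓ0 : (ℓ : ℂ) ≠ 0 := by exact_mod_cast (Fact.out : ℓ.Prime).ne_zero
  apply UpperHalfPlane.ext
  rw [coe_divPoint, heegnerTau_scaleForm_mul hQ hdisc he hdvd, coe_mulPoint]
  push_cast
  field_simp
  ring

/-- **Upward modular link**: `Φ_ℓ(j(τ_{eℓ}), j(τ_e)) = 0` where `τ_e := τ_{(a/e, b, ce)}` (`τ_{eℓ} = ℓτ_e`).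
[cite: Cox2013, §11.B (11.15)] -/
lemma evalXY_intModularPolynomial_scaleForm_up (hQ : 0 < Q.1) (hdisc : discr Q < 0) (he : 0 < e)
    (hdvd : ((e * ℓ : ℕ) : ℤ) ∣ Q.1) :
    evalXY (intModularPolynomial ℓ) (formJ (scaleForm (e * ℓ) Q)) (formJ (scaleForm e Q)) = 0 := by
  rw [formJ_eq_kleinJ, formJ_eq_kleinJ, heegnerTau_scaleForm_mul hQ hdisc he hdvd]
  exact intModularPolynomial_kleinJ_mulPoint ℓ _

/-- **Downward modular link**: `Φ_ℓ(j(τ_e), j(τ_{eℓ})) = 0` (`τ_e = (τ_{eℓ} + 0)/ℓ`).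
[cite: Cox2013, §11.B (11.15)] -/
lemma evalXY_intModularPolynomial_scaleForm_down (hQ : 0 < Q.1) (hdisc : discr Q < 0) (he : 0 < e)
    (hdvd : ((e * ℓ : ℕ) : ℤ) ∣ Q.1) :
    evalXY (intModularPolynomial ℓ) (formJ (scaleForm e Q)) (formJ (scaleForm (e * ℓ) Q)) = 0 := by
  rw [formJ_eq_kleinJ, formJ_eq_kleinJ, heegnerTau_scaleForm_eq_divPoint hQ hdisc he hdvd]
  exact intModularPolynomial_kleinJ_divPoint ℓ 0 _

end ModularLinks

/-! ### Algebraicity travels along monic links -/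

/-- If `Φ ∈ ℤ[Y][X]` is monic in `X`, `y` is algebraic and `Φ(x, y) = 0`, then `x` is algebraic (it is
integral over `ℚ(y)`). [folklore] -/
lemma isIntegral_of_evalXY_eq_zero {Φ : Polynomial (Polynomial ℤ)} (hΦ : Φ.Monic) {x y : ℂ}
    (hy : IsIntegral ℚ y) (h : evalXY Φ x y = 0) : IsIntegral ℚ x := by
  haveI : FiniteDimensional ℚ (IntermediateField.adjoin ℚ {y}) := IntermediateField.adjoin.finiteDimensional hy
  set y' : IntermediateField.adjoin ℚ {y} := ⟨y, IntermediateField.mem_adjoin_simple_self ℚ y⟩ with hy'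
  set P : Polynomial (IntermediateField.adjoin ℚ {y}) :=
    (Φ.map (mapRingHom (Int.castRingHom _))).map (evalRingHom y') with hP
  have hPmonic : P.Monic := (hΦ.map _).map _
  have hx : IsIntegral (IntermediateField.adjoin ℚ {y}) x := by
    refine ⟨P, hPmonic, ?_⟩
    have h1 : P.map (algebraMap (IntermediateField.adjoin ℚ {y}) ℂ) =
        (Φ.map (mapRingHom (Int.castRingHom ℂ))).map (evalRingHom y) := by
      rw [hP, Polynomial.map_map, Polynomial.map_map, Polynomial.map_map]
      congr 1
      refine Polynomial.ringHom_ext' (RingHom.ext_int _ _) ?_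
      simp [hy']
    rw [eval₂_eq_eval_map, h1]
    exact h
  exact isIntegral_trans x hx

/-! ### Chains: induction over the divisors of `a` -/

/-- **Integrality moves up the chain**: if `j(τ_Q)` is algebraic then so is `j(e·τ_Q)` for `e ∣ a`. [folklore] -/
lemma isIntegral_formJ_scaleForm (hQ : 0 < Q.1) (hdisc : discr Q < 0) (hint : IsIntegral ℚ (formJ Q)) :
    ∀ e : ℕ, 0 < e → (e : ℤ) ∣ Q.1 → IsIntegral ℚ (formJ (scaleForm e Q)) := by
  intro e
  induction e using Nat.strong_induction_on with
  | _ e ih =>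
    intro he hdvd
    rcases eq_or_ne e 1 with rfl | hne
    · simpa using hint
    obtain ⟨l, hl, hle⟩ := Nat.exists_prime_and_dvd hne
    haveI : Fact l.Prime := ⟨hl⟩
    obtain ⟨e', rfl⟩ := hle
    rw [mul_comm] at hdvd ⊢
    have he' : 0 < e' := Nat.pos_of_mul_pos_right (mul_comm l e' ▸ he)
    have hdvd' : (e' : ℤ) ∣ Q.1 := (Int.natCast_dvd_natCast.mpr (dvd_mul_right e' l)).trans (by exact_mod_cast hdvd)
    have ih' := ih e' (by nlinarith [hl.one_lt]) he' hdvd'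
    exact isIntegral_of_evalXY_eq_zero (monic_intModularPolynomial l) ih'
      (evalXY_intModularPolynomial_scaleForm_up hQ hdisc he' (by exact_mod_cast hdvd))

/-- **Integrality moves down the chain**: if `j(e·τ_Q)` is algebraic for some `e ∣ a` then so is `j(τ_Q)`. [folklore] -/
lemma isIntegral_formJ_of_scaleForm (hQ : 0 < Q.1) (hdisc : discr Q < 0) :
    ∀ e : ℕ, 0 < e → (e : ℤ) ∣ Q.1 → IsIntegral ℚ (formJ (scaleForm e Q)) → IsIntegral ℚ (formJ Q) := by
  intro e
  induction e using Nat.strong_induction_on with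
  | _ e ih =>
    intro he hdvd hint
    rcases eq_or_ne e 1 with rfl | hne
    · simpa using hint
    obtain ⟨l, hl, hle⟩ := Nat.exists_prime_and_dvd hne
    haveI : Fact l.Prime := ⟨hl⟩
    obtain ⟨e', rfl⟩ := hle
    rw [mul_comm] at hdvd hint
    have he' : 0 < e' := Nat.pos_of_mul_pos_right (mul_comm l e' ▸ he)
    have hdvd' : (e' : ℤ) ∣ Q.1 := (Int.natCast_dvd_natCast.mpr (dvd_mul_right e' l)).trans (by exact_mod_cast hdvd)
    refine ih e' (by nlinarith [hl.one_lt]) he' hdvd' ?_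
    exact isIntegral_of_evalXY_eq_zero (monic_intModularPolynomial l) hint
      (evalXY_intModularPolynomial_scaleForm_down hQ hdisc he' (by exact_mod_cast hdvd))

/-- **Conjugacy along the chain** (the heart of the matter): let `S ⊂ ℂ` be a finite set of algebraic numbers
containing `j(e·τ_Q)` for all `e ∣ a`, and suppose no prime factor of `a` is in `badPrimes S`.  Then
`j(e·τ_Q)` and `j(τ_Q)` have the same minimal polynomial for every `e ∣ a`.
[cite: Cox2013, §11.D proof of Thm. 11.1, (11.30)–(11.33)] -/
lemma minpoly_formJ_scaleForm {S : Finset ℂ} (hS : ∀ s ∈ S, IsIntegral ℚ s) (hQ : 0 < Q.1) (hdisc : discr Q < 0)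
    (hmem : ∀ e : ℕ, 0 < e → (e : ℤ) ∣ Q.1 → formJ (scaleForm e Q) ∈ S)
    (hgood : ∀ l : ℕ, l.Prime → (l : ℤ) ∣ Q.1 → l ∉ badPrimes S) :
    ∀ e : ℕ, 0 < e → (e : ℤ) ∣ Q.1 → minpoly ℚ (formJ (scaleForm e Q)) = minpoly ℚ (formJ Q) := by
  intro e
  induction e using Nat.strong_induction_on with
  | _ e ih =>
    intro he hdvd
    rcases eq_or_ne e 1 with rfl | hne
    · simp
    obtain ⟨l, hl, hle⟩ := Nat.exists_prime_and_dvd hne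
    haveI : Fact l.Prime := ⟨hl⟩
    obtain ⟨e', rfl⟩ := hle
    rw [mul_comm] at hdvd ⊢
    have he' : 0 < e' := Nat.pos_of_mul_pos_right (mul_comm l e' ▸ he)
    have hdvdZ : ((e' * l : ℕ) : ℤ) ∣ Q.1 := by exact_mod_cast hdvd
    have hdvd' : (e' : ℤ) ∣ Q.1 := (Int.natCast_dvd_natCast.mpr (dvd_mul_right e' l)).trans hdvdZ
    have hl_dvd : (l : ℤ) ∣ Q.1 := (Int.natCast_dvd_natCast.mpr (dvd_mul_left l e')).trans hdvdZ
    rw [← ih e' (by nlinarith [hl.one_lt]) he' hdvd']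
    exact minpoly_eq_of_modularLink hS hl (hgood l hl hl_dvd) (intModularPolynomial l)
      (dvd_coeff_coeff_intModularPolynomial_sub l) (hmem e' he' hdvd') (hmem (e' * l) (mul_comm l e' ▸ he) hdvdZ)
      (evalXY_intModularPolynomial_scaleForm_up hQ hdisc he' hdvdZ)

/-! ### Coprime representatives (Cox, Lemmas 2.3 and 2.25) -/

/-- A prime `q` divides a product of (casts of) primes iff it is one of them. [folklore] -/
lemma natCast_dvd_prod_primes_iff {q : ℕ} (hq : q.Prime) {T : Finset ℕ} (hT : ∀ t ∈ T, t.Prime) :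
    (q : ℤ) ∣ ∏ t ∈ T, (t : ℤ) ↔ q ∈ T := by
  rw [Prime.dvd_finsetProd_iff (Nat.prime_iff_prime_int.mp hq)]
  constructor
  · rintro ⟨t, ht, hdvd⟩
    rw [Int.natCast_dvd_natCast, Nat.prime_dvd_prime_iff_eq hq (hT t ht)] at hdvd
    exact hdvd ▸ ht
  · intro h
    exact ⟨q, h, dvd_rfl⟩

/-- **Every class contains a form whose first coefficient is prime to a given `M`** (Cox, Lemma 2.25 with
Lemma 2.3: the form properly represents `f(x, y)` with `x = ∏ {q ∣ M : q ∣ a, q ∤ c}`, `y = ∏ {q ∣ M : q ∤ a}`,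
which is prime to `M`; and `j` is a class invariant). [cite: Cox2013, §2.C Lemma 2.25 and §2.A Lemma 2.3] -/
lemma exists_formJ_eq_fst_coprime (hQ : 0 < Q.1) (hprim : IsPrimitive Q) (hdisc : discr Q < 0) {M : ℕ}
    (hM : M ≠ 0) : ∃ Q₂ : ℤ × ℤ × ℤ, 0 < Q₂.1 ∧ IsPrimitive Q₂ ∧ discr Q₂ = discr Q ∧ formJ Q₂ = formJ Q ∧
      Nat.Coprime Q₂.1.natAbs M := by
  set f : BinQF := ⟨Q.1, Q.2.1, Q.2.2⟩ with hf
  have hfpp : f.IsPosPrim (discr Q) := ⟨rfl, hQ, (isPrimitive_iff_binQF Q).1 hprim⟩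
  -- the two products of primes
  set A := M.primeFactors.filter (fun q : ℕ ↦ ((q : ℤ) ∣ Q.1) ∧ ¬ ((q : ℤ) ∣ Q.2.2)) with hA
  set B := M.primeFactors.filter (fun q : ℕ ↦ ¬ ((q : ℤ) ∣ Q.1)) with hB
  set x : ℤ := ∏ q ∈ A, (q : ℤ) with hx
  set y : ℤ := ∏ q ∈ B, (q : ℤ) with hy
  have hAprime : ∀ t ∈ A, t.Prime := fun t ht ↦ Nat.prime_of_mem_primeFactors (Finset.mem_filter.mp ht).1
  have hBprime : ∀ t ∈ B, t.Prime := fun t ht ↦ Nat.prime_of_mem_primeFactors (Finset.mem_filter.mp ht).1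
  have hcopxy : IsCoprime x y := by
    refine IsCoprime.prod_left fun q hq ↦ IsCoprime.prod_right fun q' hq' ↦ ?_
    rw [Nat.isCoprime_iff_coprime, Nat.coprime_primes (hAprime q hq) (hBprime q' hq')]
    rintro rfl
    exact (Finset.mem_filter.mp hq').2 (Finset.mem_filter.mp hq).2.1
  obtain ⟨u, v, huv⟩ := hcopxy
  have hdet : x * u - (-v) * y = 1 := by linear_combination huv
  set g := f.act x (-v) y u with hg
  have hgpp : g.IsPosPrim (discr Q) := hfpp.act f hdisc hdet
  have hga : g.a = Q.1 * x ^ 2 + Q.2.1 * x * y + Q.2.2 * y ^ 2 := by rw [hg, BinQF.a_act]; rfl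
  -- no prime factor of `M` divides `g.a`
  have hkey : ∀ q : ℕ, q.Prime → q ∣ M → ¬ (q : ℤ) ∣ g.a := by
    intro q hq hqM hqa
    have hqP : Prime (q : ℤ) := Nat.prime_iff_prime_int.mp hq
    have hqmem : q ∈ M.primeFactors := Nat.mem_primeFactors.mpr ⟨hq, hqM, hM⟩
    have hxdvd : (q : ℤ) ∣ x ↔ q ∈ A := natCast_dvd_prod_primes_iff hq hAprime
    have hydvd : (q : ℤ) ∣ y ↔ q ∈ B := natCast_dvd_prod_primes_iff hq hBprime
    rw [hga] at hqa
    by_cases ha : (q : ℤ) ∣ Q.1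
    · have hyq : ¬ (q : ℤ) ∣ y := fun h ↦ (Finset.mem_filter.mp (hydvd.mp h)).2 ha
      by_cases hc : (q : ℤ) ∣ Q.2.2
      · -- `q ∣ a`, `q ∣ c`, so `q ∤ b` (primitivity), `q ∤ x`, `q ∤ y`: `q ∣ bxy` impossible
        have hxq : ¬ (q : ℤ) ∣ x := fun h ↦ (Finset.mem_filter.mp (hxdvd.mp h)).2.2 hc
        have hb : ¬ (q : ℤ) ∣ Q.2.1 := by
          intro hb
          have hu := ((BinQF.isPrimitive_iff _).mp ((isPrimitive_iff_binQF Q).1 hprim)) (q : ℤ) ha hb hc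
          rw [Int.isUnit_iff] at hu
          have := hq.one_lt
          omega
        have h1 : (q : ℤ) ∣ Q.2.1 * x * y := by
          have : (q : ℤ) ∣ Q.1 * x ^ 2 + Q.2.1 * x * y + Q.2.2 * y ^ 2 - Q.1 * x ^ 2 - Q.2.2 * y ^ 2 :=
            dvd_sub (dvd_sub hqa (dvd_mul_of_dvd_left ha _)) (dvd_mul_of_dvd_left hc _)
          rwa [show Q.1 * x ^ 2 + Q.2.1 * x * y + Q.2.2 * y ^ 2 - Q.1 * x ^ 2 - Q.2.2 * y ^ 2 = Q.2.1 * x * y by ring]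
            at this
        rcases hqP.dvd_or_dvd h1 with h2 | h2
        · rcases hqP.dvd_or_dvd h2 with h3 | h3
          · exact hb h3
          · exact hxq h3
        · exact hyq h2
      · -- `q ∣ a`, `q ∤ c`: `q ∣ x`, `q ∤ y`, and `q ∣ c y²` impossible
        have hxq : (q : ℤ) ∣ x := hxdvd.mpr (Finset.mem_filter.mpr ⟨hqmem, ha, hc⟩)
        have h1 : (q : ℤ) ∣ Q.2.2 * y ^ 2 := by
          have : (q : ℤ) ∣ Q.1 * x ^ 2 + Q.2.1 * x * y + Q.2.2 * y ^ 2 - Q.1 * x ^ 2 - Q.2.1 * x * y :=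
            dvd_sub (dvd_sub hqa (dvd_mul_of_dvd_left ha _))
              (dvd_mul_of_dvd_left (dvd_mul_of_dvd_right hxq _) _)
          rwa [show Q.1 * x ^ 2 + Q.2.1 * x * y + Q.2.2 * y ^ 2 - Q.1 * x ^ 2 - Q.2.1 * x * y = Q.2.2 * y ^ 2 by ring]
            at this
        rcases hqP.dvd_or_dvd h1 with h2 | h2
        · exact hc h2
        · exact hyq (hqP.dvd_of_dvd_pow h2)
    · -- `q ∤ a`: `q ∣ y`, `q ∤ x`, and `q ∣ a x²` impossible
      have hyq : (q : ℤ) ∣ y := hydvd.mpr (Finset.mem_filter.mpr ⟨hqmem, ha⟩)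
      have hxq : ¬ (q : ℤ) ∣ x := fun h ↦ ha (Finset.mem_filter.mp (hxdvd.mp h)).2.1
      have h1 : (q : ℤ) ∣ Q.1 * x ^ 2 := by
        have : (q : ℤ) ∣ Q.1 * x ^ 2 + Q.2.1 * x * y + Q.2.2 * y ^ 2 - Q.2.1 * x * y - Q.2.2 * y ^ 2 :=
          dvd_sub (dvd_sub hqa (dvd_mul_of_dvd_right hyq _))
            (dvd_mul_of_dvd_right (dvd_pow hyq two_ne_zero) _)
        rwa [show Q.1 * x ^ 2 + Q.2.1 * x * y + Q.2.2 * y ^ 2 - Q.2.1 * x * y - Q.2.2 * y ^ 2 = Q.1 * x ^ 2 by ring]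
          at this
      rcases hqP.dvd_or_dvd h1 with h2 | h2
      · exact ha h2
      · exact hxq (hqP.dvd_of_dvd_pow h2)
  refine ⟨(g.a, g.b, g.c), hgpp.a_pos, (isPrimitive_iff_binQF _).2 hgpp.primitive, hgpp.disc_eq,
    (formJ_eq_of_properEquiv (f := f) hQ hdisc ⟨x, -v, y, u, hdet, rfl⟩).symm, ?_⟩
  refine Nat.coprime_of_dvd fun q hq hqa hqM ↦ hkey q hq hqM ?_
  exact Int.natCast_dvd.mpr hqa

/-! ### Forms with first coefficient `1` and the principal form -/

/-- **A form `(1, b, c)` has the `j`-invariant of the principal form** (`(1, b, c) ∼ (1, b + 2k, ·)`, and the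
principal form is the one with `b ∈ {0, 1}`). [cite: Cox2013, §2.A (proof of Thm. 2.8) and §2.C] -/
lemma formJ_eq_formJ_principalForm (b c : ℤ) (hdisc : discr (1, b, c) < 0) :
    formJ (1, b, c) = formJ (principalForm (discr (1, b, c))) := by
  obtain ⟨m, hm | hm⟩ := Int.even_or_odd' b
  · -- `b = 2m`: `(1, b, c)·T^{-m} = (1, 0, c − m²)`, the principal form of discriminant `4(m² − c)… = D`
    have hD : discr (1, b, c) = 4 * (m * m - c) := by rw [discr_apply, hm]; ring
    have h4 : discr (1, b, c) % 4 = 0 := by rw [hD]; generalize m * m - c = n; omega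
    have hP : principalForm (discr (1, b, c)) = (1, 0, c - m * m) := by
      unfold principalForm
      rw [if_pos h4, hD, show -(4 * (m * m - c)) = 4 * (c - m * m) by ring,
        Int.mul_ediv_cancel_left _ (by norm_num : (4 : ℤ) ≠ 0)]
    have hact : (BinQF.mk 1 b c).act 1 (-m) 0 1 = ⟨1, 0, c - m * m⟩ := by
      rw [BinQF.act_T]; ext <;> simp [hm]; ring
    have h := formJ_eq_formJ_act (BinQF.mk 1 b c) one_pos hdisc (p := 1) (q := -m) (r := 0) (s := 1)
      (by norm_num)
    rw [hact] at h
    rw [hP]; exact h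
  · -- `b = 2m + 1`: `(1, b, c)·T^{-m} = (1, 1, c − m² − m)`, the principal form of discriminant `D ≡ 1 (4)`
    have hD : discr (1, b, c) = 4 * (m * m + m - c) + 1 := by rw [discr_apply, hm]; ring
    have h4 : ¬ discr (1, b, c) % 4 = 0 := by rw [hD]; generalize m * m + m - c = n; omega
    have hP : principalForm (discr (1, b, c)) = (1, 1, c - m * m - m) := by
      unfold principalForm
      rw [if_neg h4, hD, show 1 - (4 * (m * m + m - c) + 1) = 4 * (c - m * m - m) by ring,
        Int.mul_ediv_cancel_left _ (by norm_num : (4 : ℤ) ≠ 0)]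
    have hact : (BinQF.mk 1 b c).act 1 (-m) 0 1 = ⟨1, 1, c - m * m - m⟩ := by
      rw [BinQF.act_T]; ext <;> simp [hm]; ring
    have h := formJ_eq_formJ_act (BinQF.mk 1 b c) one_pos hdisc (p := 1) (q := -m) (r := 0) (s := 1)
      (by norm_num)
    rw [hact] at h
    rw [hP]; exact h

/-- For `a > 0`, `scaleForm a (a, b, c) = (1, b, ca)`. [folklore] -/
lemma scaleForm_natAbs_fst (hQ : 0 < Q.1) : scaleForm Q.1.natAbs Q = (1, Q.2.1, Q.2.2 * Q.1) := by
  have h : ((Q.1.natAbs : ℕ) : ℤ) = Q.1 := Int.natAbs_of_nonneg hQ.le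
  simp only [scaleForm, h, Int.ediv_self hQ.ne']

/-- Hence `j(τ_{(1, b, ca)}) = j` of the principal form of discriminant `disc Q`. [folklore] -/
lemma formJ_scaleForm_natAbs_fst (hQ : 0 < Q.1) (hdisc : discr Q < 0) :
    formJ (scaleForm Q.1.natAbs Q) = formJ (principalForm (discr Q)) := by
  have hd : discr (1, Q.2.1, Q.2.2 * Q.1) = discr Q := by
    rw [← scaleForm_natAbs_fst hQ]; exact discr_scaleForm (Int.natAbs_dvd.mpr dvd_rfl)
  rw [scaleForm_natAbs_fst hQ, ← hd]
  exact formJ_eq_formJ_principalForm _ _ (hd ▸ hdisc)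

/-! ### The set of singular moduli of discriminant `D` -/

/-- `j(τ_Q)` of a primitive positive definite form is `j` of a reduced form of the same discriminant
(reduction, Cox Thm. 2.8, and class invariance of `j`; read off the tree's `isRoot_classPolynomial_holds`).
[cite: Cox2013, §2.A Thm. 2.8] -/
lemma formJ_mem_image_reducedForms (hQ : 0 < Q.1) (hprim : IsPrimitive Q) (hdisc : discr Q < 0) :
    formJ Q ∈ (reducedForms (discr Q)).image formJ := by
  have h := isRoot_classPolynomial_holds Q hQ hprim hdisc
  rw [classPolynomial, Polynomial.isRoot_prod] at h
  obtain ⟨Q', hQ', h⟩ := h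
  simp only [IsRoot.def, eval_sub, eval_X, eval_C, sub_eq_zero] at h
  exact Finset.mem_image.mpr ⟨Q', hQ', h.symm⟩

/-! ### The named fact and its proof -/

/-- **All singular moduli of a given discriminant are conjugate over `ℚ`** — the class-equation form of the
First Main Theorem of complex multiplication (Cox, §13.A Prop. 13.2 and the remark following it, p. 289:
the class equation `H_𝒪(X) = ∏_{𝔞 ∈ C(𝒪)} (X − j(𝔞ᵢ))` "is the minimal polynomial of `j(𝔞)`, where `𝔞`
is any proper fractional `𝒪`-ideal"), in the elementary language of forms: for primitive positive definite forms `Q, Q'` of the same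
discriminant `D < 0`, every rational polynomial vanishing at `j(τ_Q)` vanishes at `j(τ_{Q'})`.  Stated so
that it does not presuppose the algebraicity of `j(τ_Q)`; it is what `irreducible_classPolynomial` is used
for in `ComplexMultiplication.lean` (a rational singular modulus forces `h(D) = 1`).
[cite: Cox2013, §13.A Prop. 13.2 and the remark following it (p. 289)] -/
def singularModuli_conjugate : Prop :=
  ∀ Q Q' : ℤ × ℤ × ℤ, 0 < Q.1 → IsPrimitive Q → 0 < Q'.1 → IsPrimitive Q' → discr Q < 0 →
    discr Q' = discr Q → ∀ G : ℚ[X], aeval (formJ Q) G = 0 → aeval (formJ Q') G = 0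

/-- Every `j(τ_Q)`, `disc Q = D`, is conjugate to `j` of the principal form, once all of them are algebraic.
[cite: Cox2013, §11.D proof of Thm. 11.1, (11.30)–(11.33)] -/
lemma minpoly_formJ_eq_principalForm {D : ℤ} (hD : D < 0)
    (hSint : ∀ s ∈ (reducedForms D).image formJ, IsIntegral ℚ s)
    (hQ : 0 < Q.1) (hprim : IsPrimitive Q) (hdisc : discr Q = D) :
    minpoly ℚ (formJ Q) = minpoly ℚ (formJ (principalForm D)) := by
  subst hdisc
  set S := (reducedForms (discr Q)).image formJ with hS
  -- a modulus prime to `D` and to all bad primes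
  set M : ℕ := (discr Q).natAbs * ∏ l ∈ badPrimes S, l with hM
  have hM0 : M ≠ 0 := by
    refine Nat.mul_ne_zero (Int.natAbs_ne_zero.mpr hD.ne) (Finset.prod_ne_zero_iff.mpr fun l hl ↦ ?_)
    rcases Finset.mem_union.mp hl with h | h <;> exact (Nat.prime_of_mem_primeFactors h).ne_zero
  obtain ⟨Q₂, hQ₂, hprim₂, hdisc₂, hJ₂, hcop₂⟩ := exists_formJ_eq_fst_coprime hQ hprim hD hM0
  have hcopD : IsCoprime Q₂.1 (discr Q₂) := by
    rw [hdisc₂, Int.isCoprime_iff_gcd_eq_one]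
    show Nat.gcd Q₂.1.natAbs (discr Q).natAbs = 1
    exact (Nat.Coprime.coprime_dvd_right (dvd_mul_right _ _) hcop₂).gcd_eq_one
  have hgood : ∀ l : ℕ, l.Prime → (l : ℤ) ∣ Q₂.1 → l ∉ badPrimes S := by
    intro l hl hldvd hbad
    have h1 : l ∣ Q₂.1.natAbs := Int.natCast_dvd.mp hldvd
    have h2 : l ∣ M := Dvd.dvd.mul_left (Finset.dvd_prod_of_mem _ hbad) _
    have h3 := Nat.dvd_gcd h1 h2
    rw [hcop₂.gcd_eq_one, Nat.dvd_one] at h3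
    exact hl.one_lt.ne' h3
  have hmemS : ∀ Q' : ℤ × ℤ × ℤ, 0 < Q'.1 → IsPrimitive Q' → discr Q' = discr Q₂ → formJ Q' ∈ S := by
    intro Q' hQ' hprim' hdisc'
    have := formJ_mem_image_reducedForms hQ' hprim' (hdisc'.symm ▸ hdisc₂.symm ▸ hD)
    rwa [hdisc', hdisc₂] at this
  have hmem : ∀ e : ℕ, 0 < e → (e : ℤ) ∣ Q₂.1 → formJ (scaleForm e Q₂) ∈ S := fun e he hdvd ↦
    hmemS _ (scaleForm_fst_pos hQ₂ he hdvd) (isPrimitive_scaleForm hcopD hdvd) (discr_scaleForm hdvd)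
  have hchain := minpoly_formJ_scaleForm hSint hQ₂ (hdisc₂ ▸ hD) hmem hgood Q₂.1.natAbs
    (Int.natAbs_pos.mpr hQ₂.ne') (Int.natAbs_dvd.mpr dvd_rfl)
  rw [formJ_scaleForm_natAbs_fst hQ₂ (hdisc₂ ▸ hD), hdisc₂, hJ₂] at hchain
  exact hchain.symm

/-- **Proof of `singularModuli_conjugate`** (Cox §11.D (11.30)–(11.33) via `minpoly_eq_of_modularLink`, the
modular equation `Φ_ℓ ∈ ℤ[X, Y]` with Kronecker's congruence, chains of index-`ℓ` sublattices
`e·τ_Q`, `e ∣ a`, and coprime representatives).  No class field theory is used.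
[cite: Cox2013, §13.A Prop. 13.2; §11.D proof of Thm. 11.1] -/
theorem singularModuli_conjugate_holds : singularModuli_conjugate := by
  intro Q Q' hQ hprim hQ' hprim' hdisc hDD G hG
  by_cases hG0 : G = 0
  · simp [hG0]
  have hint : IsIntegral ℚ (formJ Q) := isAlgebraic_iff_isIntegral.mp ⟨G, hG0, hG⟩
  set D := discr Q with hDdef
  have hD : D < 0 := hdisc
  -- Step 1: `j` of the principal form is algebraic (chain from a coprime representative of `Q`)
  have hPint : IsIntegral ℚ (formJ (principalForm D)) := by
    obtain ⟨Q₂, hQ₂, hprim₂, hdisc₂, hJ₂, hcop₂⟩ :=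
      exists_formJ_eq_fst_coprime hQ hprim hdisc (M := D.natAbs) (Int.natAbs_ne_zero.mpr hD.ne)
    have h := isIntegral_formJ_scaleForm hQ₂ (hdisc₂ ▸ hD) (hJ₂ ▸ hint) Q₂.1.natAbs
      (Int.natAbs_pos.mpr hQ₂.ne') (Int.natAbs_dvd.mpr dvd_rfl)
    rwa [formJ_scaleForm_natAbs_fst hQ₂ (hdisc₂ ▸ hD), hdisc₂] at h
  -- Step 2: hence every singular modulus of discriminant `D` is algebraic
  have hSint : ∀ s ∈ (reducedForms D).image formJ, IsIntegral ℚ s := by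
    intro s hs
    obtain ⟨Qr, hQr, rfl⟩ := Finset.mem_image.mp hs
    obtain ⟨hdr, hQr0, hprimr, -⟩ := (mem_reducedForms_iff hD).1 hQr
    obtain ⟨Q₃, hQ₃, hprim₃, hdisc₃, hJ₃, hcop₃⟩ :=
      exists_formJ_eq_fst_coprime hQr0 hprimr (hdr ▸ hD) (M := D.natAbs) (Int.natAbs_ne_zero.mpr hD.ne)
    rw [← hJ₃]
    refine isIntegral_formJ_of_scaleForm hQ₃ (hdisc₃ ▸ hdr ▸ hD) Q₃.1.natAbs (Int.natAbs_pos.mpr hQ₃.ne')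
      (Int.natAbs_dvd.mpr dvd_rfl) ?_
    rwa [formJ_scaleForm_natAbs_fst hQ₃ (hdisc₃ ▸ hdr ▸ hD), hdisc₃, hdr]
  -- Step 3: conjugacy
  have hmin : minpoly ℚ (formJ Q) = minpoly ℚ (formJ Q') :=
    (minpoly_formJ_eq_principalForm hD hSint hQ hprim rfl).trans
      (minpoly_formJ_eq_principalForm hD hSint hQ' hprim' hDD).symm
  have hdvd : minpoly ℚ (formJ Q) ∣ G := minpoly.dvd ℚ _ hG
  rw [hmin] at hdvd
  exact aeval_eq_zero_of_dvd_aeval_eq_zero hdvd (minpoly.aeval ℚ _)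

end Literature.NumberTheory.EllipticCurves

end
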